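/-
Copyright (c) 2026 the pub-hodgecm-mathlib formalisation cell (harness21).  Prover seat hodgecm-mathlib-K2Liu-p10 (g6), 2026-09-04
(Track B «K2-LIT», crux hLiu418 = stmt-HodgeConjecture-24832, socket #42F′ `sig_K2LiuFirstTermIdentityOnGenerators`, ROAD I v3 («uniqueness road»),
organ U2 «rigidity» — the `hne`-FREE form of ★ `K2LiuRankOneCoefficientComparison.rankOneRigidity`, for the #42F′ TOP's FACE repair:
the per-domain non-vanishing `hne : coeff β₀ ∘ T₂ ≠ 0` of FACE-I (ED. 2) ∕ the carrier surjectivity of FACE-T∕FACE-L (ED. 3∕4) are not payable on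
the degenerate rigidity domains — e.g. `V = ⊥`, where `D_V = 0` — and are not needed).
-/
import Summits.HodgeConjecture.HodgeConjecture.Theorems.K2LiuRankOneCoefficientComparison   -- ★ U2 p858028: `rankOneRigidity`, `rankOneCoefficientComparison`
import HarnessLib

/-!
# U2 «RANK-ONE RIGIDITY» WITHOUT THE NON-VANISHING `hne`: the degenerate reference coefficient

Track B ∕ K2-LIT, hLiu418 = stmt-HodgeConjecture-24832, socket #42F′ (U6 ED. 12 :711), ROAD I v3 organ U2.  Namespace
`Summit.HodgeConjecture.HodgeConjecture.Cruxes.HLiu418.K2LiuRankOneRigidityDegenerate`.  THEOREMS ONLY (no definition, no instance, no notation, no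
named fact, no `sorry`); kernel lane `--supports stmt-HodgeConjecture-24832 --as helper`.

★ `rankOneRigidity` (K2Liu-p05 (g3)) concludes `∃ c, ∀ x, T₁ x = c • T₂ x` from the value class `P` with `hdet` (Hol.3c), the automorphy `hT₁ hT₂`, the
rank-two vanishing `h2₁ h2₂` (U2a), the class condition `hfin` (U2c-fin + signs), the LINE at the reference index `β₀ = diag(a′, 0)`
(`h₁ : coeff β₀ ∘ T₁ = c₁ • λ₀`, `h₂ : coeff β₀ ∘ T₂ = c₂ • λ₀`) AND the non-vanishing `hne : coeff β₀ ∘ T₂ ≠ 0` (U4b).  On a rigidity domain `D_V` of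
the #42F′ TOP the maps are the residue map `T₁` and the theta side `T₂ = B ∘ 𝓣`; `hne` is demanded PER DOMAIN by FACE-I (★ ED. 2
`K2LiuFirstTermIdentityAssemblyRigidity`), and FACE-T ∕ FACE-L (★ ED. 3 ∕ ED. 4) pay it from a per-domain SURJECTIVITY of the carrier `𝓣 : D_V →ₗ 𝒮(𝔸^{n″})`.
Neither is satisfiable on every domain: at `V = ⊥` the domain `D_V` is `0`, so `T₂ = 0` and no linear map `0 →ₗ 𝒮(𝔸^{n″})` is onto (more generally
`dim D_V ≤ ℵ₀ < dim 𝒮(𝔸^{n″})` for every finite-dimensional `V`).  THIS FILE removes the need: in the packaging of ED. 4 (`λ₀ := coeff β₀ ∘ T₂`, `c₂ := 1`,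
i.e. **`h₁ : coeff β₀ ∘ T₁ = c₁ • (coeff β₀ ∘ T₂)`** — the residue side's reference coefficient is a MULTIPLE of the theta side's) the conclusion holds with NO
`hne`:

* **`rankOneRigidity_of_eq_smul`** — if `coeff β₀ ∘ T₂ ≠ 0` this is ★ `rankOneRigidity` verbatim; if `coeff β₀ ∘ T₂ = 0` then `h₁` reads
  `coeff β₀ ∘ T₁ = 0 • (coeff β₀ ∘ T₂)`, so ★ `rankOneCoefficientComparison` at `c₀ := 0` makes EVERY non-zero hermitian coefficient of `T₁` vanish and ★
  `forall_eq_smul_of_coeff` with `hdet` gives `T₁ = 0 • T₂` — the constant is `c := 0`;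
* **`rankOneRigidity_of_eq_smul_split`** — the same with the class condition SPLIT BY SIDE (`hfin₁` for `T₁`, `hfin₂` for `T₂`: the bytes of FACE-L ★ ED. 4
  :235–246), the form the TOP's next edition consumes.

Consequence for the TOP (reported on `K2/STATUS.md` 2026-09-04T22:13Z): FACE-L′ := FACE-L with the conjunct `Function.Surjective 𝓣` deleted (nothing else
touched) suffices for `‹#41› → ‹FACE-L′› → ‹#42F′›` over ★ ED. 1 `firstTermIdentityOnGenerators_of_rigidityFace`.

HONEST LABEL: HC_CM is proved only modulo the 7 printed citations (2 remaining named inputs: hLiu418 = stmt-HodgeConjecture-24832, h413 =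
stmt-HodgeConjecture-24833) until rung 0 closes; this file is a count-neutral `--supports stmt-HodgeConjecture-24832` helper of organ U2 and closes no socket.

## References
* [KudlaRallis1994] S. S. Kudla, S. Rallis, *A regularized Siegel–Weil formula: the first term identity*, Ann. of Math. 140 (1994) 1–80, §3 (support and
  homogeneity of the Fourier coefficients of theta lifts and Siegel–Weil residues).
* [Omeara1963] O. T. O'Meara, *Introduction to Quadratic Forms* (1963), §65D Thm. 65:23 (Hasse norm theorem, through U2c).
* [Scharlau1985HermitianForms] W. Scharlau, *Quadratic and Hermitian Forms*, Grundlehren 270 (1985), Ch. 10 §1.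
-/

set_option autoImplicit false
set_option linter.dupNamespace false

noncomputable section

open NumberField IsDedekindDomain
open scoped Matrix
open Literature.NumberTheory.Automorphic.Liu2021.Def411WeilCarriers
open Literature.NumberTheory.GelbartRogawski1991.UnitaryDualPair
open Summit.HodgeConjecture.HodgeConjecture.Cruxes.HLiu418.K2LiuRankOneCoefficientComparison

namespace Summit.HodgeConjecture.HodgeConjecture.Cruxes.HLiu418.K2LiuRankOneRigidityDegenerate

variable (L : Type) [Field L] [NumberField L] [IsCMField L]
  {D M N : Type*} [AddCommGroup D] [Module ℂ D] [AddCommGroup M] [Module ℂ M] [AddCommGroup N] [Module ℂ N]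
  (T₁ T₂ : D →ₗ[ℂ] N) (coeff : Matrix (Fin 2) (Fin 2) L → N →ₗ[ℂ] M) (a' : (↥(maximalRealSubfield L))ˣ)
  (R : Matrix (Fin 2) (Fin 2) L → M →ₗ[ℂ] M) (S : Matrix (Fin 2) (Fin 2) L → D →ₗ[ℂ] D)
  (P : Submodule ℂ N) (hP₁ : ∀ x, T₁ x ∈ P) (hP₂ : ∀ x, T₂ x ∈ P)
  (hdet : ∀ y ∈ P, (∀ β : Matrix (Fin 2) (Fin 2) L, (β.map (IsCMField.complexConj L))ᵀ = β → β ≠ 0 → coeff β y = 0) → y = 0)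
  (hT₁ : ∀ γ : Matrix (Fin 2) (Fin 2) L, IsUnit γ.det → ∀ β : Matrix (Fin 2) (Fin 2) L,
    coeff ((γ.map (IsCMField.complexConj L))ᵀ * β * γ) ∘ₗ T₁ = R γ ∘ₗ (coeff β ∘ₗ T₁) ∘ₗ S γ)
  (hT₂ : ∀ γ : Matrix (Fin 2) (Fin 2) L, IsUnit γ.det → ∀ β : Matrix (Fin 2) (Fin 2) L,
    coeff ((γ.map (IsCMField.complexConj L))ᵀ * β * γ) ∘ₗ T₂ = R γ ∘ₗ (coeff β ∘ₗ T₂) ∘ₗ S γ)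
  (h2₁ : ∀ β : Matrix (Fin 2) (Fin 2) L, (β.map (IsCMField.complexConj L))ᵀ = β → β.det ≠ 0 → coeff β ∘ₗ T₁ = 0)
  (h2₂ : ∀ β : Matrix (Fin 2) (Fin 2) L, (β.map (IsCMField.complexConj L))ᵀ = β → β.det ≠ 0 → coeff β ∘ₗ T₂ = 0)

/-! ## §1 The class condition in ★ `rankOneRigidity`'s joint form -/

section Joint

variable
  (hfin : ∀ (b : (↥(maximalRealSubfield L))ˣ) (u : Fin 2 → L), (∃ k, u k = 1) →
    (coeff (algebraMap ↥(maximalRealSubfield L) L b • Matrix.vecMulVec (⇑(IsCMField.complexConj L) ∘ u) u) ∘ₗ T₁ ≠ 0 ∨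
      coeff (algebraMap ↥(maximalRealSubfield L) L b • Matrix.vecMulVec (⇑(IsCMField.complexConj L) ∘ u) u) ∘ₗ T₂ ≠ 0) →
    (∀ v : HeightOneSpectrum (𝓞 ↥(maximalRealSubfield L)),
        locF ↥(maximalRealSubfield L) (imagUnitSq L) b v = locF ↥(maximalRealSubfield L) (imagUnitSq L) a' v) ∧
      ∀ ρ : ↥(maximalRealSubfield L) →+* ℝ, 0 < ρ ((b : ↥(maximalRealSubfield L)) * ((a' : ↥(maximalRealSubfield L)))⁻¹))

include hP₁ hP₂ hdet hT₁ hT₂ h2₁ h2₂ hfin in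
/-- **U2 «RANK-ONE RIGIDITY» WITHOUT `hne`.**  Two maps `T₁ T₂ : D →ₗ N` into a value class `P` whose members are determined by their non-zero hermitian
coefficients (`hdet`), with coefficient families `β ↦ coeff β ∘ Tᵢ` obeying U2a (`h2ᵢ`), U2c-fin + signs (`hfin`) and automorphy (`hTᵢ`), and whose
reference coefficients at `β₀ = diag(a′, 0)` satisfy `coeff β₀ ∘ T₁ = c₁ • (coeff β₀ ∘ T₂)` (the residue side's is a MULTIPLE of the theta side's), are
PROPORTIONAL: `∃ c, ∀ x, T₁ x = c • T₂ x` — with `c := 0` when the theta side's reference coefficient vanishes (then every hermitian coefficient of `T₁`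
vanishes by ★ `rankOneCoefficientComparison` at `c₀ = 0`, so `T₁ = 0` by `hdet`), and ★ `rankOneRigidity`'s constant otherwise.
[cite: KudlaRallis1994, §3] [cite: Omeara1963, §65D Thm. 65:23] -/
theorem rankOneRigidity_of_eq_smul {c₁ : ℂ}
    (h₁ : coeff (Matrix.diagonal ![algebraMap ↥(maximalRealSubfield L) L a', 0]) ∘ₗ T₁ =
      c₁ • (coeff (Matrix.diagonal ![algebraMap ↥(maximalRealSubfield L) L a', 0]) ∘ₗ T₂)) :
    ∃ c : ℂ, ∀ x, T₁ x = c • T₂ x := by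
  by_cases hne : coeff (Matrix.diagonal ![algebraMap ↥(maximalRealSubfield L) L a', 0]) ∘ₗ T₂ = 0
  · -- degenerate reference coefficient: every non-zero hermitian coefficient of `T₁` vanishes, hence `T₁ = 0 = 0 • T₂`
    have h0 : coeff (Matrix.diagonal ![algebraMap ↥(maximalRealSubfield L) L a', 0]) ∘ₗ T₁ =
        (0 : ℂ) • (coeff (Matrix.diagonal ![algebraMap ↥(maximalRealSubfield L) L a', 0]) ∘ₗ T₂) := by
      rw [h₁, hne, smul_zero, smul_zero]
    refine ⟨0, forall_eq_smul_of_coeff T₁ T₂ coeff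
      {β : Matrix (Fin 2) (Fin 2) L | (β.map (IsCMField.complexConj L))ᵀ = β ∧ β ≠ 0} P hP₁ hP₂
      (fun y hy hyz => hdet y hy fun β hβh hβ0 => hyz β ⟨hβh, hβ0⟩) fun β hβ => ?_⟩
    exact rankOneCoefficientComparison L (fun β => coeff β ∘ₗ T₁) (fun β => coeff β ∘ₗ T₂) a' R S hT₁ hT₂ h2₁ h2₂ hfin h0 β hβ.1 hβ.2
  · -- non-degenerate: ★ `rankOneRigidity` with `λ₀ := coeff β₀ ∘ T₂`, `c₂ := 1`
    exact rankOneRigidity L T₁ T₂ coeff a' R S P hP₁ hP₂ hdet hT₁ hT₂ h2₁ h2₂ hfin h₁ (one_smul ℂ _).symm hne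

end Joint

/-! ## §2 The class condition split by side (FACE-L's `hfin₁` ∕ `hfin₂`) -/

section Split

variable
  (hfin₁ : ∀ (b : (↥(maximalRealSubfield L))ˣ) (u : Fin 2 → L), (∃ k, u k = 1) →
    coeff (algebraMap ↥(maximalRealSubfield L) L b • Matrix.vecMulVec (⇑(IsCMField.complexConj L) ∘ u) u) ∘ₗ T₁ ≠ 0 →
    (∀ v : HeightOneSpectrum (𝓞 ↥(maximalRealSubfield L)),
        locF ↥(maximalRealSubfield L) (imagUnitSq L) b v = locF ↥(maximalRealSubfield L) (imagUnitSq L) a' v) ∧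
      ∀ ρ : ↥(maximalRealSubfield L) →+* ℝ, 0 < ρ ((b : ↥(maximalRealSubfield L)) * ((a' : ↥(maximalRealSubfield L)))⁻¹))
  (hfin₂ : ∀ (b : (↥(maximalRealSubfield L))ˣ) (u : Fin 2 → L), (∃ k, u k = 1) →
    coeff (algebraMap ↥(maximalRealSubfield L) L b • Matrix.vecMulVec (⇑(IsCMField.complexConj L) ∘ u) u) ∘ₗ T₂ ≠ 0 →
    (∀ v : HeightOneSpectrum (𝓞 ↥(maximalRealSubfield L)),
        locF ↥(maximalRealSubfield L) (imagUnitSq L) b v = locF ↥(maximalRealSubfield L) (imagUnitSq L) a' v) ∧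
      ∀ ρ : ↥(maximalRealSubfield L) →+* ℝ, 0 < ρ ((b : ↥(maximalRealSubfield L)) * ((a' : ↥(maximalRealSubfield L)))⁻¹))

include hP₁ hP₂ hdet hT₁ hT₂ h2₁ h2₂ hfin₁ hfin₂ in
/-- **U2 «RANK-ONE RIGIDITY» WITHOUT `hne`, class condition split by side** — `rankOneRigidity_of_eq_smul` with `hfin := hfin₁ ∨ hfin₂` (the bytes of
FACE-L's rows `hfin₁` `hfin₂` `h₁`, ★ ED. 4 `K2LiuFirstTermIdentityAssemblyLine` :235–250): `∃ c, ∀ x, T₁ x = c • T₂ x`.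
[cite: KudlaRallis1994, §3] [cite: Omeara1963, §65D Thm. 65:23] -/
theorem rankOneRigidity_of_eq_smul_split {c₁ : ℂ}
    (h₁ : coeff (Matrix.diagonal ![algebraMap ↥(maximalRealSubfield L) L a', 0]) ∘ₗ T₁ =
      c₁ • (coeff (Matrix.diagonal ![algebraMap ↥(maximalRealSubfield L) L a', 0]) ∘ₗ T₂)) :
    ∃ c : ℂ, ∀ x, T₁ x = c • T₂ x :=
  rankOneRigidity_of_eq_smul L T₁ T₂ coeff a' R S P hP₁ hP₂ hdet hT₁ hT₂ h2₁ h2₂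
    (fun b u hu h => h.elim (hfin₁ b u hu) (hfin₂ b u hu)) h₁

end Split

end Summit.HodgeConjecture.HodgeConjecture.Cruxes.HLiu418.K2LiuRankOneRigidityDegenerate

end
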